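import Mathlib.NumberTheory.Cyclotomic.CyclotomicCharacter
import Mathlib.Algebra.CharP.Defs
import Mathlib.FieldTheory.IsAlgClosed.Basic
import Mathlib.NumberTheory.Padics.HeightOneSpectrum
import Mathlib.RingTheory.RootsOfUnity.AlgebraicallyClosed
import Mathlib.FieldTheory.KrullTopology
import Mathlib.Topology.Instances.ZMod
import Literature.NumberTheory.GaloisRepresentations.GaloisRep
import Literature.NumberTheory.GaloisRepresentations.ArtinConductor
import Literature.NumberTheory.GaloisRepresentations.LocalGaloisGroup
import HarnessLib

-- D-0014 sorry-sweep (operator, 2026-08-13): sorried theorems -> named facts `def X : Prop`; partial proofs preserved in comments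
-- provenance: harness21/H21/H21/Prelude/GalRep/ModPGaloisRep.lean @ e07a0a9 (interim HEAD d8f2665); M5 mechanical rewrite
/-!
# Mod `p` Galois representations (trunk GalRep, item C15 = `G09:ModPGaloisRep`)

Notion `mod_p_galois_representation` (part 1) and the prime-to-`p` `conductor`: continuous
representations `ρ̄ : Γ_K → GL_n(k)` with `k` a discrete field of characteristic `p`
(typically `k = 𝔽̄_p`, hypotheses `[CharP k p] [IsAlgClosed k] [DiscreteTopology k]` imposed
only where used; no instance is put on `AlgebraicClosure (ZMod p)`), Serre's level `N(ρ̄)`,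
the mod `p` cyclotomic character, Serre's fundamental characters of the inertia group of a
local field, and the shapes of `ρ̄|I` entering the recipe for Serre's weight (item C16).

## Main definitions

* `Literature.ModPGaloisRep K k n := Literature.FramedGaloisRep K k n` (an `abbrev`: `toGaloisRep`, `toLocal`,
  `IsUnramifiedAt`, `FramedGaloisRep.IsOdd`, `FramedRep.det`, … apply verbatim);
  `ModPGaloisRep.IsIrreducible`; `ModPGaloisRep.finite_range` (sorried).
* `ModPGaloisRep.serreLevel p ρ̄ : ℕ` for `ρ̄ : ModPGaloisRep ℚ k 2`: `∏_{ℓ ≠ p} ℓ ^ a_ℓ(ρ̄)`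
  as a `finprod` over `HeightOneSpectrum (𝓞 ℚ)` identified with `Nat.Primes` by Mathlib's
  `Rat.HeightOneSpectrum.primesEquiv`, exponents from `GaloisRep.artinConductorExponent`
  (item C10); `not_dvd_serreLevel` (proved), `serreLevel_eq_artinConductorNat_div`.
* `Literature.modPCyclotomicCharacter K k p ι : Γ_K →ₜ* kˣ` (`[NeZero (p : K)]`, `ι : ZMod p →+* k`),
  built from Mathlib's `modularCyclotomicCharacter` on `K̄`; **continuity is proved** (kernel
  contains the open subgroup `Gal(K̄/K(ζ_p))`, `IntermediateField.fixingSubgroup_isOpen`);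
  `modPCyclotomicCharacter_spec`; compatibility `toZMod_cyclotomicCharacter_eq` with the
  `p`-adic character of item C6 (sorried).
* Local (`F` a non-archimedean local field, `S = absIntegers 𝒪[F] F`, `𝔓 = absMaximalIdeal F`,
  `I_F = absInertia F`, items C3–C4): `Literature.NumberTheory.GaloisRepresentations.kummerRoot`, `kummerCocycle σ = σ(z)/z`,
  `kummerCharacterQuot : I_F →* S ⧸ 𝔓` (multiplicativity **proved** from the definition of
  inertia), `kummerCharacter : I_F →* kˣ`, and
  `Literature.fundamentalCharacter F m ι ϖ hϖ : I_F →* kˣ`, Serre's fundamental character of level `m`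
  (`z ^ (q ^ m - 1) = ϖ`); `fundamentalCharacter_eq` (independence of `ϖ`),
  `fundamentalCharacter_pow` (`ψ_m ^ ((q^m-1)/(q-1)) = ψ_1`), `fundamentalCharacter_one_pow_eq_one`
  (proved).
* `ModPGaloisRep.HasLevelOneInertiaShape`, `HasLevelTwoInertiaShape`, `IsTamelyRamified`
  (`isTamelyRamified_iff_isTameAt`, proved) for `ρ̄_F : ModPGaloisRep F k 2` over an abstract
  local field `F`.  (The global `ρ̄.toLocal v_p` lives over `v_p.adicCompletion ℚ`, which has no
  `IsNonarchimedeanLocalField` instance in Mathlib; item C16 bridges this with instance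
  arguments, OUTLINE D2.)

## Mathlib declarations used rather than redefined

`modularCyclotomicCharacter`, `modularCyclotomicCharacter.spec/unique`,
`HasEnoughRootsOfUnity.natCard_rootsOfUnity`, `AlgebraicClosure.hasEnoughRootsOfUnity` (needs
exactly `[NeZero (p : K)]`), `IntermediateField.fixingSubgroup_isOpen`,
`Rat.HeightOneSpectrum.primesEquiv` (no `ofNatPrime` helper is introduced),
`IsAlgClosed.exists_pow_nat_eq`, `IsIntegral.of_pow`, `Ideal.inertia`, `Ideal.Quotient.mk`,
`MonoidHom.toHomUnits`, `finprod`.  Mathlib has no mod `p` Galois representation type, no Serre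
level/weight, no fundamental characters (grep `fundamental.*haracter`, `Serre.*level`,
`tame.*haracter` in `Mathlib/`: no relevant hits).

## Design choices

* **Explicit residue embedding and uniformiser (OUTLINE §4.9, review 6).**  `absMaximalIdeal F`
  is data but its maximality is a sorried theorem, so `S ⧸ 𝔓` is not known to Lean to be a
  field.  Every construction needing "the residue field `𝔽̄_q` inside `k`" therefore takes
  `ι : S ⧸ 𝔓 →+* k` as an explicit argument, and the uniformiser `ϖ : 𝒪[F]` is passed as an
  `Irreducible` element (Mathlib's `IsDiscreteValuationRing` convention).  `#print axioms` on
  `kummerCharacter`, `fundamentalCharacter`, `modPCyclotomicCharacter`, `serreLevel` shows no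
  `sorryAx`.
* **Kummer character into `kˣ`.**  We first build the honest monoid homomorphism
  `I_F →* S ⧸ 𝔓`, `σ ↦ σ(z)/z (mod 𝔓)`; multiplicativity is the computation
  `c(στ) = σ(c(τ))·c(σ) ≡ c(τ)·c(σ) (mod 𝔓)` because `σ ∈ I_F` means `σ x - x ∈ 𝔓` for all
  `x ∈ S` (Mathlib's definition of `Ideal.inertia`).  Units are then obtained for free from
  `MonoidHom.toHomUnits` (a hom out of a group lands in units), so no `Units.mk0` /
  non-vanishing argument is needed.
* **Choice of root.**  `kummerRoot` is a `Classical.choose`; on `I_F` the character is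
  independent of it and of `ϖ` up to units (any two roots differ by a unit `w` of `S`, and
  `σ(w)/w ≡ 1 (mod 𝔓)` on inertia): `kummerCharacter_eq_of_associated`, `fundamentalCharacter_eq`
  (sorried).  Dependence on `ι` is up to a Frobenius power, as in Serre.
* **Junk values.**  `fundamentalCharacter F 0 … = 1` (the exponent `q ^ 0 - 1 = 0` is
  degenerate); `serreLevel` is a `finprod` (junk `1` if infinitely many exponents are non-zero,
  which cannot happen for finite image).  `serreLevel_eq_artinConductorNat_div` uses exact `ℕ`
  division by the `p`-part.
* `HasLevelTwoInertiaShape` uses `q = residueFieldCard F` in the exponents `a + q b`, `q a + b`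
  (`q = p` for `F = ℚ_p`, Serre's setting).
* Namespaces: everything is in `Literature`/`Literature.NumberTheory.GaloisRepresentations.ModPGaloisRep`; nothing is added to Mathlib
  namespaces.

## References

* J.-P. Serre, *Sur les représentations modulaires de degré 2 de `Gal(ℚ̄/ℚ)`*, Duke Math. J. 54
  (1987), §§1.1–1.4 (`ρ̄`, `N(ρ̄)`, `χ`), §§2.1–2.4 (structure of `ρ̄|I_p`, fundamental
  characters, tame/wild cases). [Serre1987]
* J.-P. Serre, *Propriétés galoisiennes des points d'ordre fini des courbes elliptiques*, Invent.
  Math. 15 (1972), §§1.3–1.8 (tame inertia, characters `θ_d`, fundamental characters of level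
  `m`, formula (10)). [SerreInventiones1972]
* J.-P. Serre, *Abelian ℓ-adic representations and elliptic curves* (1968), Ch. I §1.2
  (the cyclotomic character). [SerreAbelianLadic1968]
* B. Edixhoven, *The weight in Serre's conjectures on modular forms*, Invent. Math. 109 (1992),
  §2 (level and shapes of `ρ̄|I`).
-/

noncomputable section

open scoped NumberField Pointwise Valued
open Field IsDedekindDomain ValuativeRel

namespace Literature.NumberTheory.GaloisRepresentations

universe u v

/-! ### The carrier -/

section Carrier

variable (K : Type u) [Field K] (k : Type v) [Field k] [TopologicalSpace k]

/-- A **mod `p` Galois representation** of rank `n` of the field `K` with coefficients in the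
(discrete, typically algebraically closed of characteristic `p`) field `k`: a continuous
homomorphism `ρ̄ : Γ_K →ₜ* GL_n(k)`, i.e. an `Literature.FramedGaloisRep K k n`.  This is an `abbrev`,
so all the framed API (`toGaloisRep`, `toLocal`, `IsUnramifiedAt`, `IsOdd`, `FramedRep.det`,
`FramedRep.conj`, …) applies verbatim; the hypotheses `[CharP k p] [IsAlgClosed k]
[DiscreteTopology k]` are imposed only where needed.
Ref: J.-P. Serre, *Sur les représentations modulaires de degré 2 de Gal(ℚ̄/ℚ)*, Duke Math. J.
54 (1987), §1.1, §3.1. [folklore] -/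
abbrev ModPGaloisRep (n : ℕ) := FramedGaloisRep K k n

variable {K k} {n : ℕ}

namespace ModPGaloisRep

/-- A continuous representation of the profinite group `Γ_K` over a *discrete* field has open
kernel and hence **finite image**.
Ref: Serre, Duke Math. J. 54 (1987), §1.1 ("`ρ` est continue, donc d'image finie").
[cite: Serre1987, §1.1] -/
def finite_range : Prop :=
  ∀ [DiscreteTopology k] (ρ : ModPGaloisRep K k n),
    (Set.range ρ).Finite

/-- A mod `p` representation is **irreducible** if the underlying representation of `Γ_K` on
`Fin n → k` is (`Literature.NumberTheory.GaloisRepresentations.FramedRep.IsIrreducible`, Mathlib `Representation.IsIrreducible`);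
definitionally `ρ̄.toGaloisRep.IsIrreducible` (`isIrreducible_iff_toGaloisRep`).
Ref: Serre, Duke Math. J. 54 (1987), §1.2, (3.2.3). [folklore] -/
protected abbrev IsIrreducible (ρ : ModPGaloisRep K k n) : Prop :=
  FramedRep.IsIrreducible ρ

/-- `ModPGaloisRep.IsIrreducible` is irreducibility of `ρ̄.toGaloisRep`
(`Literature.NumberTheory.GaloisRepresentations.ContinuousRep.IsIrreducible`). [folklore] -/
lemma isIrreducible_iff_toGaloisRep [IsTopologicalRing k] (ρ : ModPGaloisRep K k n) :
    ρ.IsIrreducible ↔ ρ.toGaloisRep.IsIrreducible :=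
  Iff.rfl

/-- **Oddness** of a mod `p` representation is `Literature.NumberTheory.GaloisRepresentations.FramedGaloisRep.IsOdd` (`det ρ̄(c) = -1`
for all complex conjugations `c`); restated here for discoverability.
Ref: Serre, Duke Math. J. 54 (1987), §1.1, §3.1 (hypothesis "`ρ` impaire"). [folklore] -/
lemma isOdd_iff (ρ : ModPGaloisRep K k n) :
    FramedGaloisRep.IsOdd ρ ↔ ∀ (φ : K →+* ℝ) (c : absoluteGaloisGroup K),
      IsComplexConjugation φ c → Matrix.GeneralLinearGroup.det (ρ c) = -1 :=
  Iff.rfl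

end ModPGaloisRep

end Carrier

/-! ### Serre's level `N(ρ̄)` -/

section Level

variable {k : Type v} [Field k] [TopologicalSpace k] [IsTopologicalRing k]
  (p : ℕ) [Fact p.Prime]

namespace ModPGaloisRep

/-- **Serre's level** `N(ρ̄) = ∏_{ℓ ≠ p} ℓ ^ {n(ℓ, ρ̄)}` of a mod `p` representation
`ρ̄ : Γ_ℚ → GL₂(k)`: the prime-to-`p` part of the Artin conductor, where
`n(ℓ, ρ̄) = artinConductorExponent v_ℓ ρ̄` (item C10) and finite places of `ℚ` are identified
with rational primes by Mathlib's `Rat.HeightOneSpectrum.primesEquiv`.  A `finprod`; if `ρ̄`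
is not unramified almost everywhere (which does not happen, `finite_range`) it returns the junk
value `1`.
Ref: Serre, Duke Math. J. 54 (1987), §1.2, (1.2.1)–(1.2.2). [folklore] -/
def serreLevel (ρ : ModPGaloisRep ℚ k 2) : ℕ :=
  ∏ᶠ v : HeightOneSpectrum (𝓞 ℚ),
    if ((Rat.HeightOneSpectrum.primesEquiv v : Nat.Primes) : ℕ) = p then 1
    else ((Rat.HeightOneSpectrum.primesEquiv v : Nat.Primes) : ℕ) ^
      (FramedGaloisRep.toGaloisRep ρ).artinConductorExponent v

/-- `N(ρ̄)` is the prime-to-`p` part of the numerical Artin conductor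
`artinConductorNat ρ̄ = |𝔣(ρ̄)|` (item C10), for `ρ̄` unramified almost everywhere.
Ref: Serre, Duke Math. J. 54 (1987), §1.2. [cite: Serre1987, §1.2 (definition of N(ρ))] -/
def serreLevel_eq_artinConductorNat_div : Prop :=
  ∀ (ρ : ModPGaloisRep ℚ k 2) (hρ : (FramedGaloisRep.toGaloisRep ρ).IsUnramifiedAE),
    serreLevel p ρ = (FramedGaloisRep.toGaloisRep ρ).artinConductorNat /
      p ^ ((FramedGaloisRep.toGaloisRep ρ).artinConductorNat).factorization p

/-- `N(ρ̄)` is prime to `p`.  Ref: Serre, Duke Math. J. 54 (1987), §1.2, (1.2.2). [folklore] -/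
theorem not_dvd_serreLevel (ρ : ModPGaloisRep ℚ k 2) : ¬ p ∣ serreLevel p ρ := by
  have hp : p.Prime := Fact.out
  refine finprod_induction (fun x => ¬ p ∣ x) hp.not_dvd_one
    (fun x y hx hy hxy => (hp.dvd_mul.mp hxy).elim hx hy) fun v => ?_
  split_ifs with h
  · exact hp.not_dvd_one
  · exact fun hdvd =>
      h (Nat.prime_eq_prime_of_dvd_pow hp (Rat.HeightOneSpectrum.primesEquiv v).2 hdvd).symm

end ModPGaloisRep

end Level

/-! ### The mod `p` cyclotomic character -/

section Cyclotomic

variable (K : Type u) [Field K] (k : Type v) [Field k] [TopologicalSpace k] [IsTopologicalRing k]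
  (p : ℕ) [Fact p.Prime] [NeZero (p : K)]

open scoped IntermediateField

/-- The mod `p` cyclotomic character on ring automorphisms of `K̄`, valued in `(ZMod p)ˣ`:
Mathlib's `modularCyclotomicCharacter` for `L = AlgebraicClosure K` and `n = p`, using that `K̄`
has `p` `p`-th roots of unity when `p ≠ char K` (`AlgebraicClosure.hasEnoughRootsOfUnity`,
which needs exactly `[NeZero (p : K)]`).  Auxiliary for `modPCyclotomicCharacter`.
Ref: Serre, Duke Math. J. 54 (1987), §1.4; Mathlib
`Mathlib/NumberTheory/Cyclotomic/CyclotomicCharacter.lean`. [folklore] -/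
def modPCyclotomicCharacterZMod :
    absoluteGaloisGroup K →* (ZMod p)ˣ :=
  (modularCyclotomicCharacter (AlgebraicClosure K)
      (HasEnoughRootsOfUnity.natCard_rootsOfUnity (AlgebraicClosure K) p)).comp
    (MulSemiringAction.toRingAut (absoluteGaloisGroup K) (AlgebraicClosure K))

/-- Defining property of `modPCyclotomicCharacterZMod`: `σ • t = t ^ χ̄(σ)` for every `p`-th
root of unity `t ∈ K̄` (Mathlib `modularCyclotomicCharacter.spec`).
Ref: Serre, Duke Math. J. 54 (1987), §1.4. [folklore] -/
lemma modPCyclotomicCharacterZMod_spec (σ : absoluteGaloisGroup K) (t : AlgebraicClosure K)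
    (ht : t ^ p = 1) :
    σ • t = t ^ ((modPCyclotomicCharacterZMod K p σ : ZMod p)).val := by
  have h := modularCyclotomicCharacter.spec (AlgebraicClosure K)
    (HasEnoughRootsOfUnity.natCard_rootsOfUnity (AlgebraicClosure K) p)
    (MulSemiringAction.toRingAut (absoluteGaloisGroup K) (AlgebraicClosure K) σ)
    (t := rootsOfUnity.mkOfPowEq t ht) (rootsOfUnity.mkOfPowEq t ht).2
  exact h

/-- The mod `p` cyclotomic character is trivial on `Gal(K̄/K(ζ_p))` for a primitive `p`-th root
of unity `ζ`.  Ref: Serre, Duke Math. J. 54 (1987), §1.4. [folklore] -/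
lemma modPCyclotomicCharacterZMod_eq_one_of_mem_fixingSubgroup {ζ : AlgebraicClosure K}
    (hζ : IsPrimitiveRoot ζ p) (σ : absoluteGaloisGroup K)
    (hσ : σ ∈ (IntermediateField.fixingSubgroup K⟮ζ⟯ : Subgroup (absoluteGaloisGroup K))) :
    modPCyclotomicCharacterZMod K p σ = 1 := by
  ext
  refine (modularCyclotomicCharacter.unique (AlgebraicClosure K)
    (HasEnoughRootsOfUnity.natCard_rootsOfUnity (AlgebraicClosure K) p) _ fun t ht => ?_).symm
  obtain ⟨i, -, rfl⟩ := (hζ.isUnit_unit NeZero.out).eq_pow_of_mem_rootsOfUnity ht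
  rw [Units.val_one, ZMod.val_one, pow_one]
  exact hσ ⟨ζ ^ i, pow_mem (IntermediateField.mem_adjoin_simple_self K ζ) _⟩

/-- The **mod `p` cyclotomic character** `χ̄_p : Γ_K →ₜ* kˣ` of a field `K` with `p ≠ char K`,
with values pushed into the coefficient field `k` along a ring homomorphism `ι : ZMod p →+* k`
(for `[CharP k p]` this is the unique one, `ZMod.castHom`): `σ ζ = ζ ^ {χ̄_p(σ)}` for all
`ζ ∈ μ_p(K̄)` (`modPCyclotomicCharacter_spec`).  Underlying homomorphism:
`Units.map ι ∘ modularCyclotomicCharacter K̄ ∘ (Γ_K → (K̄ ≃+* K̄))`.  Continuity is proved: the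
kernel contains the open subgroup `Gal(K̄/K(ζ_p))` (`IntermediateField.fixingSubgroup_isOpen`),
so the character is locally constant.
Ref: Serre, Duke Math. J. 54 (1987), §1.4 ("le caractère cyclotomique `χ : G_ℚ → 𝔽_p^*`");
Mathlib `modularCyclotomicCharacter`. [folklore] -/
def modPCyclotomicCharacter (ι : ZMod p →+* k) : absoluteGaloisGroup K →ₜ* kˣ where
  toMonoidHom := (Units.map ι.toMonoidHom).comp (modPCyclotomicCharacterZMod K p)
  continuous_toFun := by
    set χ : absoluteGaloisGroup K →* kˣ :=
      (Units.map ι.toMonoidHom).comp (modPCyclotomicCharacterZMod K p) with hχ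
    change Continuous χ
    refine continuous_of_continuousAt_one χ ?_
    rw [ContinuousAt, map_one]
    refine Filter.Tendsto.mono_right ?_ (pure_le_nhds 1)
    rw [Filter.tendsto_pure]
    obtain ⟨ζ, hζ⟩ := HasEnoughRootsOfUnity.exists_primitiveRoot (AlgebraicClosure K) p
    haveI : FiniteDimensional K K⟮ζ⟯ :=
      IntermediateField.adjoin.finiteDimensional
        ((hζ.isIntegral (Nat.pos_of_neZero _)).tower_top)
    let U : Set (absoluteGaloisGroup K) :=
      {σ | σ ∈ (IntermediateField.fixingSubgroup K⟮ζ⟯ : Subgroup (absoluteGaloisGroup K))}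
    have hopen : IsOpen U := IntermediateField.fixingSubgroup_isOpen K⟮ζ⟯
    have hU : U ∈ nhds (1 : absoluteGaloisGroup K) :=
      hopen.mem_nhds (one_mem (IntermediateField.fixingSubgroup K⟮ζ⟯))
    filter_upwards [hU] with σ hσ
    simp only [hχ, MonoidHom.coe_comp, Function.comp_apply]
    rw [modPCyclotomicCharacterZMod_eq_one_of_mem_fixingSubgroup K p hζ σ hσ, map_one]

/-- Unfolding lemma: the value of `modPCyclotomicCharacter` in `k` is `ι` of the value of
`modPCyclotomicCharacterZMod` in `ZMod p`. [folklore] -/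
@[simp] lemma coe_modPCyclotomicCharacter_apply (ι : ZMod p →+* k) (σ : absoluteGaloisGroup K) :
    (modPCyclotomicCharacter K k p ι σ : k) = ι (modPCyclotomicCharacterZMod K p σ : ZMod p) :=
  rfl

/-- **Defining property of the mod `p` cyclotomic character**: if `χ̄_p(σ) = ι a` in `k` for
`a : ZMod p`, then `σ • t = t ^ a` for every `t ∈ K̄` with `t ^ p = 1` (and such an `a` exists,
namely `modPCyclotomicCharacterZMod K p σ`; `ι` is injective as `ZMod p` is a field).
Ref: Serre, Duke Math. J. 54 (1987), §1.4. [folklore] -/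
theorem modPCyclotomicCharacter_spec (ι : ZMod p →+* k) (σ : absoluteGaloisGroup K)
    {a : ZMod p} (ha : (modPCyclotomicCharacter K k p ι σ : k) = ι a) (t : AlgebraicClosure K)
    (ht : t ^ p = 1) : σ • t = t ^ a.val := by
  rw [coe_modPCyclotomicCharacter_apply] at ha
  rw [← ι.injective ha]
  exact modPCyclotomicCharacterZMod_spec K p σ t ht

/-- **Compatibility with the `p`-adic cyclotomic character** (item C6,
`GaloisRep.cyclotomicCharacter K p : Γ_K →ₜ* ℤ_[p]ˣ`): `χ̄_p = ι ∘ (χ_p mod p)`, via Mathlib's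
`cyclotomicCharacter.toZModPow` and `PadicInt.toZMod`.
Ref: Serre, Duke Math. J. 54 (1987), §1.4; Serre, *Abelian ℓ-adic representations* (1968),
Ch. I §1.2 ([SerreAbelianLadic1968]). [cite: Serre1987, §1.4] -/
def toZMod_cyclotomicCharacter_eq : Prop :=
  ∀ (ι : ZMod p →+* k) (σ : absoluteGaloisGroup K),
    ι (PadicInt.toZMod ((GaloisRep.cyclotomicCharacter K p σ : ℤ_[p]ˣ) : ℤ_[p])) =
      (modPCyclotomicCharacter K k p ι σ : k)

end Cyclotomic

/-! ### Fundamental characters of the inertia group of a local field -/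

section Local

open GaloisRepresentations.IsNonarchimedeanLocalField

section Kummer

variable (F : Type u) [Field F] [ValuativeRel F] {n : ℕ} (hn : 0 < n) (a : 𝒪[F])

/-- A **chosen `n`-th root** `z ∈ S = absIntegers 𝒪[F] F` of `a ∈ 𝒪[F]` (`z ^ n = a` in
`F̄`), obtained by `Classical.choose` from `IsAlgClosed.exists_pow_nat_eq`; it is integral over
`𝒪[F]` as a root of `X ^ n - a` (`IsIntegral.of_pow`).  The Kummer character on inertia built
from it does not depend on the choice (`kummerCharacter_eq_of_associated`).
Ref: Serre, *Propriétés galoisiennes des points d'ordre fini des courbes elliptiques*, Invent.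
Math. 15 (1972), §1.3–1.7. [folklore] -/
def kummerRoot : absIntegers 𝒪[F] F :=
  ⟨(IsAlgClosed.exists_pow_nat_eq (algebraMap 𝒪[F] (AlgebraicClosure F) a) hn).choose,
    IsIntegral.of_pow hn (by
      rw [(IsAlgClosed.exists_pow_nat_eq (algebraMap 𝒪[F] (AlgebraicClosure F) a) hn).choose_spec]
      exact isIntegral_algebraMap)⟩

/-- `kummerRoot ^ n = a` in `F̄`.  Ref: Serre, Invent. Math. 15 (1972), §1.3. [folklore] -/
lemma coe_kummerRoot_pow :
    (kummerRoot F hn a : AlgebraicClosure F) ^ n = algebraMap 𝒪[F] (AlgebraicClosure F) a :=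
  (IsAlgClosed.exists_pow_nat_eq (algebraMap 𝒪[F] (AlgebraicClosure F) a) hn).choose_spec

variable {F a} in
/-- The chosen root of a non-zero element is non-zero. [folklore] -/
lemma coe_kummerRoot_ne_zero (ha : a ≠ 0) : (kummerRoot F hn a : AlgebraicClosure F) ≠ 0 := by
  intro h
  have h1 := coe_kummerRoot_pow F hn a
  rw [h, zero_pow hn.ne', IsScalarTower.algebraMap_apply 𝒪[F] F (AlgebraicClosure F), eq_comm,
    map_eq_zero, map_eq_zero_iff _ Subtype.val_injective] at h1
  exact ha h1

/-- The **Kummer cocycle** `σ ↦ σ(z) / z ∈ F̄` of the chosen root `z = kummerRoot F hn a`; an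
`n`-th root of unity (`kummerCocycle_pow`), satisfying the cocycle identity `kummerCocycle_mul`.
Ref: Serre, Invent. Math. 15 (1972), §1.3, §1.7. [folklore] -/
def kummerCocycle (σ : absoluteGaloisGroup F) : AlgebraicClosure F :=
  σ • (kummerRoot F hn a : AlgebraicClosure F) / kummerRoot F hn a

/-- `Γ_F` fixes `a ∈ 𝒪[F] ⊆ F`. [folklore] -/
lemma smul_algebraMap_valuationInteger (σ : absoluteGaloisGroup F) :
    σ • algebraMap 𝒪[F] (AlgebraicClosure F) a = algebraMap 𝒪[F] (AlgebraicClosure F) a := by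
  rw [IsScalarTower.algebraMap_apply 𝒪[F] F (AlgebraicClosure F), absoluteGaloisGroup.smul_def,
    AlgEquiv.commutes]

/-- The Kummer cocycle takes values in `n`-th roots of unity: `(σ z / z) ^ n = 1`.
Ref: Serre, Invent. Math. 15 (1972), §1.3. [folklore] -/
lemma kummerCocycle_pow {a} (ha : a ≠ 0) (σ : absoluteGaloisGroup F) :
    kummerCocycle F hn a σ ^ n = 1 := by
  rw [kummerCocycle, div_pow, ← smul_pow', coe_kummerRoot_pow, smul_algebraMap_valuationInteger,
    div_self]
  rw [← coe_kummerRoot_pow F hn a]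
  exact pow_ne_zero _ (coe_kummerRoot_ne_zero hn ha)

/-- The cocycle identity `c(στ) = σ(c(τ)) · c(σ)`.  Ref: Serre, Invent. Math. 15 (1972), §1.3. [folklore] -/
lemma kummerCocycle_mul {a} (ha : a ≠ 0) (σ τ : absoluteGaloisGroup F) :
    kummerCocycle F hn a (σ * τ) = σ • kummerCocycle F hn a τ * kummerCocycle F hn a σ := by
  have hz := coe_kummerRoot_ne_zero (F := F) hn ha
  have hσz : σ • (kummerRoot F hn a : AlgebraicClosure F) ≠ 0 := by
    rw [absoluteGaloisGroup.smul_def]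
    exact (map_ne_zero _).mpr hz
  simp only [kummerCocycle, mul_smul, absoluteGaloisGroup.smul_def, map_div₀] at hσz ⊢
  rw [div_mul_div_cancel₀ hσz]

/-- `c(1) = 1`.  Ref: Serre, Invent. Math. 15 (1972), §1.3. [folklore] -/
lemma kummerCocycle_one {a} (ha : a ≠ 0) : kummerCocycle F hn a 1 = 1 := by
  rw [kummerCocycle, one_smul, div_self (coe_kummerRoot_ne_zero hn ha)]

/-- The Kummer cocycle is integral over `𝒪[F]` (a root of unity), hence lies in `S`. [folklore] -/
lemma isIntegral_kummerCocycle {a} (ha : a ≠ 0) (σ : absoluteGaloisGroup F) :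
    IsIntegral 𝒪[F] (kummerCocycle F hn a σ) :=
  IsIntegral.of_pow hn (by rw [kummerCocycle_pow F hn ha]; exact isIntegral_one)

/-- The Kummer cocycle as an element of `S = absIntegers 𝒪[F] F`.
Ref: Serre, Invent. Math. 15 (1972), §1.3. [folklore] -/
def kummerCocycleInt {a : 𝒪[F]} (ha : a ≠ 0) (σ : absoluteGaloisGroup F) : absIntegers 𝒪[F] F :=
  ⟨kummerCocycle F hn a σ, isIntegral_kummerCocycle F hn ha σ⟩

/-- Unfolding lemma for `kummerCocycleInt`. [folklore] -/
@[simp] lemma coe_kummerCocycleInt {a : 𝒪[F]} (ha : a ≠ 0) (σ : absoluteGaloisGroup F) :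
    (kummerCocycleInt F hn ha σ : AlgebraicClosure F) = kummerCocycle F hn a σ :=
  rfl

variable [TopologicalSpace F] [IsNonarchimedeanLocalField F]

/-- The **mod `𝔓` Kummer character of the inertia group** `I_F → (S ⧸ 𝔓)`,
`σ ↦ σ(z)/z mod 𝔓` for the chosen root `z` of `z ^ n = a` (`𝔓 = absMaximalIdeal F`, item C4).
It is multiplicative because `σ ∈ I_F` acts trivially on `S ⧸ 𝔓` (definition of
`Ideal.inertia`), so `c(στ) = σ(c(τ)) c(σ) ≡ c(τ) c(σ)`; this proof uses only the ideal `𝔓`,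
not its (sorried) maximality (OUTLINE §4.9).
Ref: Serre, Invent. Math. 15 (1972), §1.3, §1.7; Serre, Duke Math. J. 54 (1987), §2.1. [folklore] -/
def kummerCharacterQuot {a : 𝒪[F]} (ha : a ≠ 0) :
    ↥(absInertia F) →* absIntegers 𝒪[F] F ⧸ absMaximalIdeal F where
  toFun σ := Ideal.Quotient.mk _ (kummerCocycleInt F hn ha σ)
  map_one' := by
    rw [← map_one (Ideal.Quotient.mk (absMaximalIdeal F))]
    congr 1
    exact Subtype.ext (kummerCocycle_one F hn ha)
  map_mul' σ τ := by
    rw [← map_mul, Ideal.Quotient.eq]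
    have h : kummerCocycleInt F hn ha ((σ * τ : absInertia F) : absoluteGaloisGroup F) =
        (σ : absoluteGaloisGroup F) • kummerCocycleInt F hn ha τ * kummerCocycleInt F hn ha σ :=
      Subtype.ext (kummerCocycle_mul F hn ha σ τ)
    rw [h, mul_comm (kummerCocycleInt F hn ha σ), ← sub_mul]
    exact Ideal.mul_mem_right _ _ (σ.2 _)

variable {k : Type v} [Field k]

/-- The **Kummer character** `I_F → kˣ`, `σ ↦ ι(σ(z)/z mod 𝔓)` attached to `a ∈ 𝒪[F] ∖ {0}`,
`n > 0` and a residue embedding `ι : S ⧸ 𝔓 →+* k` (an explicit argument, OUTLINE §4.9); values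
are units since `I_F` is a group (`MonoidHom.toHomUnits`).  For `a = ϖ` a uniformiser and
`n = q ^ m - 1` this is the fundamental character of level `m` (`fundamentalCharacter`).
Ref: Serre, Invent. Math. 15 (1972), §1.7, Prop. 3; Serre, Duke Math. J. 54 (1987), §2.1. [folklore] -/
def kummerCharacter {a : 𝒪[F]} (ha : a ≠ 0) (ι : absIntegers 𝒪[F] F ⧸ absMaximalIdeal F →+* k) :
    ↥(absInertia F) →* kˣ :=
  (ι.toMonoidHom.comp (kummerCharacterQuot F hn ha)).toHomUnits

/-- Unfolding lemma for `kummerCharacter`. [folklore] -/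
@[simp] lemma coe_kummerCharacter_apply {a : 𝒪[F]} (ha : a ≠ 0)
    (ι : absIntegers 𝒪[F] F ⧸ absMaximalIdeal F →+* k) (σ : absInertia F) :
    (kummerCharacter F hn ha ι σ : k) = ι (Ideal.Quotient.mk _ (kummerCocycleInt F hn ha σ)) :=
  rfl

/-- **Independence of choices.**  On the inertia group the Kummer character does not depend on
the chosen root `z` nor on `a` up to units: if `a' = u a` with `u ∈ 𝒪[F]ˣ` then any two roots
`z, z'` differ by a unit `w ∈ Sˣ` (`w ^ n = u`), and `σ(w)/w ≡ 1 (mod 𝔓)` for `σ ∈ I_F`.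
Ref: Serre, Invent. Math. 15 (1972), §1.7, Prop. 3 and Remarque.
[cite: SerreInventiones1972, §1.7, Prop. 3 and Remarque] -/
def kummerCharacter_eq_of_associated : Prop :=
  ∀ {a a' : 𝒪[F]} (ha : a ≠ 0) (ha' : a' ≠ 0) (h : Associated a a') (ι : absIntegers 𝒪[F] F ⧸ absMaximalIdeal F →+* k),
    kummerCharacter F hn ha ι = kummerCharacter F hn ha' ι

end Kummer

variable (F : Type u) [Field F] [ValuativeRel F] [TopologicalSpace F] [IsNonarchimedeanLocalField F]

section Fundamental

variable {k : Type v} [Field k]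

/-- The exponent `q ^ m - 1` of the level-`m` fundamental character is positive for `m ≠ 0`
(`q = residueFieldCard F > 1`). [folklore] -/
lemma residueFieldCard_pow_sub_one_pos {m : ℕ} (hm : m ≠ 0) :
    0 < residueFieldCard F ^ m - 1 :=
  Nat.sub_pos_of_lt (one_lt_pow₀ (one_lt_residueFieldCard F) hm)

/-- The **fundamental character of level `m`** `ψ_m : I_F → kˣ` of the inertia group of the
non-archimedean local field `F` (Serre): `σ ↦ ι(σ(z)/z mod 𝔓)` where `z ∈ F̄` is a chosen root
of `z ^ (q ^ m - 1) = ϖ`, `q = #𝓀[F]`, `ϖ` a uniformiser of the discrete valuation ring `𝒪[F]`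
(given as an `Irreducible` element, Mathlib's `IsDiscreteValuationRing` convention) and
`ι : S ⧸ 𝔓 →+* k` an embedding of the residue field of `F̄` into `k`.  Both `ι` and `ϖ` are
explicit arguments (OUTLINE §4.9: no definition depends on the sorried maximality of `𝔓`); the
result is independent of `ϖ` and of the root (`fundamentalCharacter_eq`), and depends on `ι`
up to Frobenius (a power `ψ_m ^ q^i`).  For `m = 0` the exponent `q ^ 0 - 1 = 0` is degenerate
and the **junk value** is the trivial character.
Ref: Serre, Invent. Math. 15 (1972), §1.7 ("caractères fondamentaux de niveau `m`"); Serre,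
Duke Math. J. 54 (1987), §2.1. [folklore] -/
def fundamentalCharacter (m : ℕ) (ι : absIntegers 𝒪[F] F ⧸ absMaximalIdeal F →+* k) (ϖ : 𝒪[F])
    (hϖ : Irreducible ϖ) : ↥(absInertia F) →* kˣ :=
  if hm : m = 0 then 1
  else kummerCharacter F (residueFieldCard_pow_sub_one_pos F hm) hϖ.ne_zero ι

/-- Unfolding lemma for `fundamentalCharacter` at a non-zero level. [folklore] -/
lemma fundamentalCharacter_of_ne_zero {m : ℕ} (hm : m ≠ 0)
    (ι : absIntegers 𝒪[F] F ⧸ absMaximalIdeal F →+* k) (ϖ : 𝒪[F]) (hϖ : Irreducible ϖ) :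
    fundamentalCharacter F m ι ϖ hϖ =
      kummerCharacter F (residueFieldCard_pow_sub_one_pos F hm) hϖ.ne_zero ι := by
  rw [fundamentalCharacter, dif_neg hm]

/-- **Independence of the uniformiser** (and of the chosen root): two uniformisers of the DVR
`𝒪[F]` are associated, so the fundamental characters agree (`kummerCharacter_eq_of_associated`).
Ref: Serre, Invent. Math. 15 (1972), §1.7, Prop. 3. [cite: SerreInventiones1972, §1.7, Prop. 3] -/
def fundamentalCharacter_eq : Prop :=
  ∀ (m : ℕ) (ι : absIntegers 𝒪[F] F ⧸ absMaximalIdeal F →+* k) (ϖ ϖ' : 𝒪[F]) (hϖ : Irreducible ϖ) (hϖ' : Irreducible ϖ'),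
    fundamentalCharacter F m ι ϖ hϖ = fundamentalCharacter F m ι ϖ' hϖ'

/-- **Norm compatibility of fundamental characters**: `ψ_m ^ ((q ^ m - 1)/(q - 1)) = ψ_1`
(more generally `ψ_{md} ^ ((q^{md}-1)/(q^m-1)) = ψ_m`), since `z_m ^ ((q^m-1)/(q-1))` is a
`(q-1)`-th root of `ϖ`.
Ref: Serre, Invent. Math. 15 (1972), §1.7, (10). [cite: SerreInventiones1972, §1.7, eq. (10)] -/
def fundamentalCharacter_pow : Prop :=
  ∀ (m : ℕ) (hm : m ≠ 0) (ι : absIntegers 𝒪[F] F ⧸ absMaximalIdeal F →+* k) (ϖ : 𝒪[F]) (hϖ : Irreducible ϖ),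
    fundamentalCharacter F m ι ϖ hϖ ^ ((residueFieldCard F ^ m - 1) / (residueFieldCard F - 1)) =
      fundamentalCharacter F 1 ι ϖ hϖ

/-- The level-one fundamental character has order dividing `q - 1`: `ψ_1 ^ (q - 1) = 1`.
Ref: Serre, Invent. Math. 15 (1972), §1.7, §1.8 (`ψ_1 = θ_{q-1}`). [folklore] -/
theorem fundamentalCharacter_one_pow_eq_one
    (ι : absIntegers 𝒪[F] F ⧸ absMaximalIdeal F →+* k) (ϖ : 𝒪[F]) (hϖ : Irreducible ϖ) :
    fundamentalCharacter F 1 ι ϖ hϖ ^ (residueFieldCard F - 1) = 1 := by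
  rw [fundamentalCharacter_of_ne_zero F one_ne_zero]
  ext σ : 2
  have h1 : residueFieldCard F - 1 = residueFieldCard F ^ 1 - 1 := by rw [pow_one]
  rw [MonoidHom.pow_apply, Units.val_pow_eq_pow_val, coe_kummerCharacter_apply, ← map_pow,
    ← map_pow, h1, MonoidHom.one_apply, Units.val_one, ← ι.map_one, ← map_one (Ideal.Quotient.mk _)]
  congr 2
  exact Subtype.ext (kummerCocycle_pow F _ hϖ.ne_zero σ)

end Fundamental

/-! ### Shapes of `ρ̄|I_F` for two-dimensional mod `p` representations (Serre §2) -/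

namespace ModPGaloisRep

variable {F}
variable {k : Type v} [Field k] [TopologicalSpace k]

/-- `ρ̄|I_F` has **level-one shape with exponents `(a, b)`**: in a suitable basis
(`P ∈ GL₂(k)`), for every `σ ∈ I_F`,
`P ρ̄(σ) P⁻¹ = (χ(σ)^a  *; 0  χ(σ)^b)` with `χ = ψ_1` the level-one fundamental character
(`fundamentalCharacter F 1 ι ϖ hϖ`; for `F = ℚ_p`, `χ` is the mod `p` cyclotomic character
restricted to inertia).  This is case (2.1.b)/(2.4) of Serre (wild inertia may act through
`*`).
Ref: Serre, Duke Math. J. 54 (1987), §2.1, (2.1.2)–(2.1.3), §2.3–2.4. [folklore] -/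
def HasLevelOneInertiaShape (ρ : ModPGaloisRep F k 2)
    (ι : absIntegers 𝒪[F] F ⧸ absMaximalIdeal F →+* k) (ϖ : 𝒪[F]) (hϖ : Irreducible ϖ)
    (a b : ℕ) : Prop :=
  ∃ P : GL (Fin 2) k, ∀ σ : absInertia F, ∃ c : k,
    ((P * ρ (σ : absoluteGaloisGroup F) * P⁻¹ : GL (Fin 2) k) : Matrix (Fin 2) (Fin 2) k) =
      !![((fundamentalCharacter F 1 ι ϖ hϖ σ ^ a : kˣ) : k), c;
        0, ((fundamentalCharacter F 1 ι ϖ hϖ σ ^ b : kˣ) : k)]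

/-- `ρ̄|I_F` has **level-two shape with exponents `(a, b)`**: in a suitable basis, for every
`σ ∈ I_F`, `P ρ̄(σ) P⁻¹ = diag(ψ(σ)^(a + q b), ψ(σ)^(q a + b))` with `ψ = ψ_2` the level-two
fundamental character and `q = #𝓀[F]` (`= p` for `F = ℚ_p`; the two exponents are the
`Gal(𝔽_{q²}/𝔽_q)`-conjugates `ψ, ψ' = ψ^q`).  This is case (2.1.a) of Serre; then `ρ̄|I_F` is
tame.
Ref: Serre, Duke Math. J. 54 (1987), §2.1, (2.1.1), §2.2. [folklore] -/
def HasLevelTwoInertiaShape (ρ : ModPGaloisRep F k 2)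
    (ι : absIntegers 𝒪[F] F ⧸ absMaximalIdeal F →+* k) (ϖ : 𝒪[F]) (hϖ : Irreducible ϖ)
    (a b : ℕ) : Prop :=
  ∃ P : GL (Fin 2) k, ∀ σ : absInertia F,
    ((P * ρ (σ : absoluteGaloisGroup F) * P⁻¹ : GL (Fin 2) k) : Matrix (Fin 2) (Fin 2) k) =
      !![((fundamentalCharacter F 2 ι ϖ hϖ σ ^ (a + residueFieldCard F * b) : kˣ) : k), 0;
        0, ((fundamentalCharacter F 2 ι ϖ hϖ σ ^ (residueFieldCard F * a + b) : kˣ) : k)]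

variable {n : ℕ}

/-- `ρ̄` is **tamely ramified**: the wild inertia group acts trivially, i.e. every
upper-numbering ramification group `I_F^v = absUpperInertia F v` with `v > 0` (item C9) lies in
the kernel.  Agrees with `GaloisRep.IsTameAt 𝒪[F] (absMaximalIdeal F) ρ̄.toGaloisRep`
(item C10; `isTamelyRamified_iff_isTameAt`).
Ref: Serre, Duke Math. J. 54 (1987), §2.1–2.2; Serre, *Local Fields*, Ch. IV §2, Cor. 3. [folklore] -/
def IsTamelyRamified (ρ : ModPGaloisRep F k n) : Prop :=
  ∀ v : ℝ, 0 < v → ∀ σ ∈ absUpperInertia F v, ρ σ = 1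

/-- `IsTamelyRamified` agrees with `GaloisRep.IsTameAt` of the associated representation on
`Fin n → k` at `𝔓 = absMaximalIdeal F` (the standard representation of `GL_n` is faithful).
Ref: Serre, *Local Fields*, Ch. VI §2. [folklore] -/
theorem isTamelyRamified_iff_isTameAt [IsTopologicalRing k] (ρ : ModPGaloisRep F k n) :
    ρ.IsTamelyRamified ↔ ρ.toGaloisRep.IsTameAt 𝒪[F] (absMaximalIdeal F) := by
  refine forall₂_congr fun v _ => forall₂_congr fun σ _ => ?_
  change ρ σ = 1 ↔ FramedRep.toRepresentation ρ σ = 1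
  constructor
  · intro h
    refine LinearMap.ext fun w => ?_
    simp [h]
  · intro h
    have h1 : Matrix.toLin' ((ρ σ : GL (Fin n) k) : Matrix (Fin n) (Fin n) k) =
        Matrix.toLin' 1 := by
      rw [Matrix.toLin'_one]
      refine LinearMap.ext fun w => ?_
      simpa using congr($h w)
    exact Units.ext (Matrix.toLin'.injective h1)

/-- A representation with level-two inertia shape is tamely ramified (its restriction to
`I_F` factors through the abelian tame quotient `I_F / P_F`).
Ref: Serre, Duke Math. J. 54 (1987), §2.1, Prop. 1 ff. [cite: Serre1987, §2.1, Prop. 1] -/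
def HasLevelTwoInertiaShape.isTamelyRamified : Prop :=
  ∀ {ρ : ModPGaloisRep F k 2} {ι : absIntegers 𝒪[F] F ⧸ absMaximalIdeal F →+* k} {ϖ : 𝒪[F]} {hϖ : Irreducible ϖ} {a b : ℕ} (h : ρ.HasLevelTwoInertiaShape ι ϖ hϖ a b),
    ρ.IsTamelyRamified

end ModPGaloisRep

end Local

end Literature.NumberTheory.GaloisRepresentations
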